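import Mathlib.RingTheory.Localization.FractionRing
import Mathlib.Algebra.Field.Basic
import HarnessLib

/-!
# (W0) CORE ALGEBRA — `Δ` is a unit (S7 of the core plan), pure ring lemma

Topic `Literature/RingTheory/Localization` (proofs only). The last step of the `ω`-argument
(Bosch–Lütkebohmert–Raynaud §4.3 / Edixhoven–Romagny Thm. 6.3, «`φ^* ω' = b ω'`, … this implies
`r = 0`»), in the one-component case where the frame at `γ = m(ξ)` is reused at `η_s`: in a field
`F` (the function field of `𝒳 ×_R 𝒳`) containing the chart ring `C` (`j : C → F` injective), with
the two ring maps `ι₂, m♯ : B → C` (second projection and multiplication) whose `F`-extensions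
`φ₂, μ♯ : K(E) → F` agree with them on `B ⊆ K(E)`, the invariance identity
`μ♯(f) · j(Δ) = φ₂(f)` for a coefficient `f ∈ K(E)` with `f · π^N = π^M · u`, `u ∈ Bˣ`, `π ∈ R`
non-zero in `F` and fixed by `φ₂, μ♯`, forces `Δ · m♯(u) = ι₂(u)` in `C`, so `Δ` is a unit of `C`.
-/

namespace Literature.RingTheory.Localization

/-- **`Δ` is a unit** (core algebra of the `ω`-argument in the one-component case): see the module
docstring. [cite: EdixhovenRomagny2012, Thm. 6.3 (proof: «this implies that r = 0»)] -/
theorem isUnit_of_cocycle_identity {B C L F : Type*} [CommRing B] [CommRing C] [Field L]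
    [Field F] (j : C →+* F) (hj : Function.Injective j) (ι₂ m : B →+* C) (iB : B →+* L)
    (φ₂ μ : L →+* F) (hφ₂ : ∀ b : B, φ₂ (iB b) = j (ι₂ b)) (hμ : ∀ b : B, μ (iB b) = j (m b))
    (π : B) (hπφ : φ₂ (iB π) = μ (iB π)) (hπ0 : j (ι₂ π) ≠ 0)
    {f : L} {u : Bˣ} {N M : ℕ} (hf : f * iB π ^ N = iB π ^ M * iB u) (Δ : C)
    (hΔ : μ f * j Δ = φ₂ f) : IsUnit Δ := by
  -- multiply the identity by `μ (π^N) = φ₂ (π^N)` and substitute `f π^N = π^M u`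
  have hπN : φ₂ (iB π ^ N) = μ (iB π ^ N) := by rw [map_pow, map_pow, hπφ]
  have hπM : φ₂ (iB π ^ M) = μ (iB π ^ M) := by rw [map_pow, map_pow, hπφ]
  have h1 : μ (f * iB π ^ N) * j Δ = φ₂ (f * iB π ^ N) := by
    rw [map_mul, map_mul, ← hπN, mul_right_comm, hΔ]
  rw [hf, map_mul, map_mul, ← hπM, hμ u, hφ₂ u, mul_assoc] at h1
  -- cancel `φ₂ (π^M) ≠ 0`
  have hπM0 : φ₂ (iB π ^ M) ≠ 0 := by
    rw [map_pow, hφ₂]; exact pow_ne_zero _ hπ0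
  have h2 : j (m u) * j Δ = j (ι₂ u) := mul_left_cancel₀ hπM0 h1
  rw [← map_mul] at h2
  have h3 : m u * Δ = ι₂ u := hj h2
  -- `m u`, `ι₂ u` are units
  have hmu : IsUnit (m (u : B)) := (Units.isUnit u).map m
  have hιu : IsUnit (ι₂ (u : B)) := (Units.isUnit u).map ι₂
  rw [← h3] at hιu
  exact isUnit_of_mul_isUnit_right hιu

end Literature.RingTheory.Localization
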